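import Literature.Probability.Percolation.TriRSWRounds
import Literature.Probability.Percolation.NearCriticalExpDecay
import Literature.Probability.Percolation.TriCorrLengthLeaves
import HarnessLib

/-!
# The start of Nolin's Lemma 39 without a Russo–Seymour–Welsh hypothesis; `ν = 4/3` from two leaves

Topic `Literature/Probability/Percolation`; family `crit-perc`. Part of the bottom-up discharge of
`Literature.Probability.Percolation.triCorrLength_exponent` (`ξ(p) = |p - 1/2|^{-4/3 + o(1)}` for site
percolation on `𝕋`, Smirnov–Werner 2001, Thm. 1 (iii)–(iv)). Before this file the exponent
followed from three named facts (`triCorrLength_exponent_of_leaves₃`, `TriCorrLengthLeaves.lean`):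
the four-arm exponent `fourArm_exponent`, the near-critical pivotal count `Werner2009_lemma62`,
and the "moreover" clause `Nolin2008_RSW_one` of Nolin's Russo–Seymour–Welsh theorem
(`f_k(δ) → 1` as `δ → 1`), whose only use was the START of the block argument of Nolin's
Lemma 39 (`NearCriticalExpDecay.lemma39_start_of_RSW_one`: at `L = L_ε(p)`,
`324 P_p(LR_𝕋(L, 3L)) ≤ e^{-1}`). This file proves that start unconditionally
(`lemma39_start_holds`), at a scale `n₀ ≤ L_ε(p)` instead of exactly `L_ε(p)` — which is just as
good for Lemma 39 (`Nolin2008_lemma39_at_of_start'`) — and concludes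

* `Nolin2008_lemma39_at_holds_small : ∃ ε₀ > 0, ∀ ε ≤ ε₀, Nolin2008_lemma39_at ε`;
* `triCorrLength_exponent_of_leaves₂ : fourArm_exponent → Werner2009_lemma62 →
  triCorrLength_exponent`.

## The argument

Nolin (2008, proof of Lemma 39) takes the start from the RSW theorem: "The RSW theory thus
entails (Theorem 2) that for all fixed `ε₁ > 0`, we can take `ε₀` sufficiently small to get
automatically (and independently of `p`) that `P_p(𝒞_H([0, L] × [0, 2L])) ≤ ε₁`." We obtain it
from the TWO-SCALE Russo–Seymour–Welsh bounds of `TriRSWRounds.lean` (Bollobás–Riordan's Lemma 4 /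
Cor. 5 in lattice hexagons, iterated; flexible second scale `m ∈ [4j - 2, 4j + 2]`):
(MP) `P_p(LR(2j, 2j)) ≥ θ` and `P_p(LR(m, m)) ≥ θ` imply `P_p(LR(12j + 6, 4j + 2)) ≥ φ(θ) > 0`;
(MS) for the tolerance `θ = t(η)`, `P_q(LR(2j, 2j)) ≥ 1 - θ` and `P_q(LR(m, m)) ≥ 1 - θ` imply
`P_q(LR(12j + 6, 4j + 2)) ≥ 1 - η`, `η = e^{-1}/324`.
Fix `p < 1/2`, `L = L_ε(p)` with `ε < φ(θ)`, so `P_p(LR(L, L)) ≤ ε` (definition of `L_ε`), and call a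
scale `k` *strong* if `P_p(LR(k, k)) < θ`, i.e. (exact duality `P_p(LR(m, n)) + P_{1-p}(LR(n, m)) = 1`)
the closed sites cross `R(k, k)` with probability `> 1 - θ`.
* (F) For `4j + 2 ≤ L ≤ 12j + 6` and `m ∈ [4j - 2, 4j + 2]`, at least one of `2j`, `m` is strong:
  otherwise (MP) gives `φ ≤ P_p(LR(12j + 6, 4j + 2)) ≤ P_p(LR(L, L)) ≤ ε < φ`.
* (G) If both `2j` and `m` are strong for some such `j`, then (MS) for the closed sites (density
  `1 - p`) and duality give `P_p(LR(4j + 2, 12j + 6)) ≤ η`: the start holds at `n₀ = 4j + 2 ≤ L`.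
* Combinatorics (`exists_pair_of_forall_or`): (F) without (G) on the whole range
  `j ∈ [⌈(L-6)/12⌉, ⌊(L-2)/4⌋]` is impossible for `L ≥ 100` — with `m = 4j + 2`, which is an
  admissible second scale both for `j` and for `j + 1`, strength of `2j` would alternate strictly
  along `j ↦ 2j + 1` and at the same time be constant along `j ↦ j + 1`.
* Small `L < 100`: `p^{L+1} ≤ P_p(LR(L, L)) ≤ ε` forces `p ≤ ε^{1/100}`, and then
  `P_p(LR(1, 3)) ≤ 4p` gives the start at `n₀ = 1`.
The decay itself is Nolin's block argument verbatim (`triLRCrossingProb_decay_of_start`, the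
proof of `Nolin2008_lemma39_at_of_start` with `n₀` in place of `L_ε(p)`), and
`e^{-n/(4 n₀)} ≤ e^{-n/(4 L_ε(p))}` for `n₀ ≤ L_ε(p)`.

Remark. This does not prove the single-scale statement `Nolin2008_RSW_one` itself (nor
`Nolin2008_RSW`); it removes them from the proof of `ν = 4/3`, whose remaining named inputs are
`fourArm_exponent` (Smirnov–Werner 2001, Thm. 1, `j = 4`) and `Werner2009_lemma62`.

## References

* P. Nolin, *Near-critical percolation in two dimensions*, Electron. J. Probab. 13 (2008), §3.1
  Theorem "Russo–Seymour–Welsh" (arXiv 0711.4948: Thm. 2), §7.4 Lemma 39 / Remark 40 (arXiv: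
  Lemma 37 / Remark 38) and its proof [Nolin2008].
* S. Smirnov, W. Werner, *Critical exponents for two-dimensional percolation*, Math. Res. Lett. 8
  (2001), Thm. 1 (iii)–(iv) [SmirnovWernerMRL2001].
* B. Bollobás, O. Riordan, *Percolation*, CUP (2006), Ch. 3, Lemma 4, Cor. 5 [BollobasRiordan2006].
* H. Kesten, Scaling relations for 2D-percolation, *Comm. Math. Phys.* 109 (1987), Lemma (2.24)
  (the block argument) [KestenScalingCMP1987].

## Mathlib / tree

Mathlib: `Real.exp`, `Nat.log` (through `exists_scale_between`), `pow_le_pow_iff_left₀`,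
`sitePercolation`-free measure theory (`measureReal_biUnion_finset_le`). Tree:
`TriRSWRounds.lean` (`TriHexagon.triLRCrossingProb_two_scale_flex`,
`TriHexagon.triLRCrossingProb_two_scale_flex_one`), `NearCriticalExpDecay.lean`
(`triLRCrossingProb_rec`, `sq_iter_le`, `exists_scale_between`,
`triSitePercolation_real_triHCross_le_bands`), `TriHexExclusive.lean` (`triLRCrossingProb_add_eq_one`),
`TriRSWChaining.lean` (`triLRCrossingProb_anti_width`, `triHCross_zero_zero`), `TriShiftedCrossings.lean`
(`triLRCrossingProb_mono_height`), `KestenScaling.lean` (`charLength`, `triLRCrossingProb_charLength_le`),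
`NearCriticalCorrelationLengthLower.lean` (`pow_succ_le_triLRCrossingProb`, `triLRCrossingProb_le_mul`), `NearCriticalCorrelationLength.lean` (`Nolin2008_lemma39_at`),
`TriCorrLengthLeaves.lean` (`triCorrLength_exponent_of_lemma39_at'`), `KestenRelationRussoProofs.lean`
(`Nolin2008_prop34_of_expDecay`), `TriSubcriticalCrossingProofs.lean` (`BollobasRiordan2006_tri_expDecay_holds`).
-/

noncomputable section

open MeasureTheory Set Filter Topology
open scoped unitInterval

namespace Literature.Probability.Percolation

open LatticeModels

/-! ### Lemma 39 from a start at any scale `n₀ ≤ L_ε(p)` -/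

/-- **Uniform exponential decay from a start at scale `n₀`** (Nolin 2008, proof of Lemma 39, with
`n₀` in place of `L(p)`): if `324 P_p(LR_𝕋(n₀, 3n₀)) ≤ e^{-1}` and `n₀ ≥ 1`, then for every `k ≥ 1`
and every `n`, `P_p(LR_𝕋(n, k n)) ≤ (k + 2) e^{1/4} e^{-n / (4 n₀)}` (the block recursion
`triLRCrossingProb_rec`, the squaring iteration `sq_iter_le` and the covering by bands, exactly as
in `Nolin2008_lemma39_at_of_start`). [cite: Nolin2008, §7.4 Lemma 39, Remark 40 (arXiv: Lemma 37, Remark 38), proof] -/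
theorem triLRCrossingProb_decay_of_start (p : unitInterval) {n₀ : ℕ} (hn₀ : 1 ≤ n₀)
    (hstart : 324 * triLRCrossingProb p n₀ (3 * n₀) ≤ Real.exp (-1)) {k : ℕ} (hk : 1 ≤ k) (n : ℕ) :
    triLRCrossingProb p n (k * n) ≤ (k + 2) * Real.exp (1 / 4) * Real.exp (-(1 / 4 * n / n₀)) := by
  set L := n₀ with hLdef
  have hL1 : (1 : ℝ) ≤ L := by exact_mod_cast hn₀
  have hLpos : (0 : ℝ) < L := by linarith
  have hP1 : triLRCrossingProb p n (k * n) ≤ 1 := measureReal_le_one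
  have hk2 : (1 : ℝ) ≤ k + 2 := by
    have : (0 : ℝ) ≤ k := by positivity
    linarith
  have e1 : (1 : ℝ) ≤ Real.exp (1 / 4) := by linarith [Real.add_one_le_exp (1 / 4 : ℝ)]
  rcases lt_or_ge n L with hnL | hnL
  · -- small `n`: the bound exceeds `1`
    have h1 : (1 : ℝ) ≤ Real.exp (1 / 4) * Real.exp (-(1 / 4 * n / L)) := by
      rw [← Real.exp_add]
      have : (n : ℝ) / L ≤ 1 := by
        rw [div_le_one hLpos]; exact_mod_cast hnL.le
      have h' : 1 / 4 * (n : ℝ) / L = 1 / 4 * ((n : ℝ) / L) := by ring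
      have h'' : (0 : ℝ) ≤ 1 / 4 + -(1 / 4 * n / L) := by rw [h']; linarith
      linarith [Real.add_one_le_exp (1 / 4 + -(1 / 4 * (n : ℝ) / L))]
    calc triLRCrossingProb p n (k * n) ≤ 1 := hP1
      _ ≤ (k + 2 : ℝ) * (Real.exp (1 / 4) * Real.exp (-(1 / 4 * n / L))) :=
          one_le_mul_of_one_le_of_one_le hk2 h1
      _ = _ := by ring
  · -- `n ≥ L`: the scale `w = n_j ≤ n < n_{j+1}`
    obtain ⟨j, hj1, hj2⟩ := exists_scale_between hnL
    obtain ⟨w, hw⟩ : ∃ w : ℕ, w = 2 ^ j * (L + 1) - 1 := ⟨_, rfl⟩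
    rw [← hw] at hj1
    have hw1 : 1 ≤ 2 ^ j * (L + 1) := Nat.one_le_iff_ne_zero.2 (by positivity)
    have hw2 : 2 ^ (j + 1) * (L + 1) = 2 * (w + 1) := by
      have : 2 ^ (j + 1) * (L + 1) = 2 * (2 ^ j * (L + 1)) := by ring
      omega
    have hrec : ∀ m : ℕ, 324 * triLRCrossingProb p (2 * m + 1) (3 * (2 * m + 1)) ≤
        (324 * triLRCrossingProb p m (3 * m)) ^ 2 := fun m => by
      have := triLRCrossingProb_rec p m
      nlinarith [this, (measureReal_nonneg : 0 ≤ triLRCrossingProb p m (3 * m))]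
    have hb : 324 * triLRCrossingProb p w (3 * w) ≤ Real.exp (-2 ^ j) := by
      rw [hw]
      exact sq_iter_le (b := fun m => 324 * triLRCrossingProb p m (3 * m))
        (fun m => mul_nonneg (by norm_num) measureReal_nonneg) hrec hstart j
    have hn2w : n ≤ 2 * w := by omega
    have hbands : ((k * n / (w + 1) + 1 : ℕ) : ℝ) ≤ 2 * k := by
      have h1 : k * n ≤ k * (2 * w) := Nat.mul_le_mul_left k hn2w
      have h2 : k * (2 * w) < 2 * k * (w + 1) := by nlinarith
      have : k * n / (w + 1) < 2 * k :=
        (Nat.div_lt_iff_lt_mul (by positivity : 0 < w + 1)).2 (by omega)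
      exact_mod_cast (show k * n / (w + 1) + 1 ≤ 2 * k by omega)
    have hmain : triLRCrossingProb p n (k * n) ≤ 6 * k * triLRCrossingProb p w (3 * w) := by
      calc triLRCrossingProb p n (k * n) ≤ triLRCrossingProb p w (k * n) :=
            triLRCrossingProb_anti_width p hj1 _
        _ = (triSitePercolation p).real (triHCross 0 0 w (k * n)) := by
            rw [triLRCrossingProb, triHCross_zero_zero]
        _ ≤ 3 * ((k * n / (w + 1) + 1 : ℕ) : ℝ) * triLRCrossingProb p w (3 * w) :=
            triSitePercolation_real_triHCross_le_bands p 0 w (k * n) le_rfl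
        _ ≤ 3 * (2 * k) * triLRCrossingProb p w (3 * w) :=
            mul_le_mul_of_nonneg_right (by linarith [hbands]) measureReal_nonneg
        _ = 6 * k * triLRCrossingProb p w (3 * w) := by ring
    have hexp : Real.exp (-2 ^ j) ≤ Real.exp (-(1 / 4 * n / L)) := by
      rw [Real.exp_le_exp, neg_le_neg_iff, div_le_iff₀ hLpos]
      have h1 : ((n : ℝ) + 1) < 2 ^ (j + 1) * ((L : ℝ) + 1) := by exact_mod_cast hj2
      have h2 : (L : ℝ) + 1 ≤ 2 * L := by linarith
      have h3 : (2 : ℝ) ^ (j + 1) = 2 * 2 ^ j := by rw [pow_succ]; ring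
      have h4 : (2 : ℝ) ^ (j + 1) * ((L : ℝ) + 1) ≤ 4 * 2 ^ j * L := by
        rw [h3]; nlinarith [h2, pow_pos (two_pos : (0 : ℝ) < 2) j]
      nlinarith [h1, h4]
    have e2 : 0 ≤ Real.exp (-(1 / 4 * (n : ℝ) / L)) := (Real.exp_pos _).le
    have hk54 : (k : ℝ) / 54 ≤ (k + 2) * Real.exp (1 / 4) := by
      have := mul_le_mul_of_nonneg_left e1 (by positivity : (0 : ℝ) ≤ k + 2)
      have : (0 : ℝ) ≤ k := by positivity
      linarith
    calc triLRCrossingProb p n (k * n) ≤ 6 * k * triLRCrossingProb p w (3 * w) := hmain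
      _ = (k : ℝ) / 54 * (324 * triLRCrossingProb p w (3 * w)) := by ring
      _ ≤ (k : ℝ) / 54 * Real.exp (-2 ^ j) := by gcongr
      _ ≤ (k : ℝ) / 54 * Real.exp (-(1 / 4 * n / L)) := by gcongr
      _ ≤ (k + 2 : ℝ) * Real.exp (1 / 4) * Real.exp (-(1 / 4 * n / L)) :=
          mul_le_mul_of_nonneg_right hk54 e2

/-- **Lemma 39 (and Remark 40) at `ε` from a start at any scale below `L_ε(p)`**: if for every
`p < 1/2` with `L_ε(p) ≥ 1` there is a scale `1 ≤ n₀ ≤ L_ε(p)` with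
`324 P_p(LR_𝕋(n₀, 3n₀)) ≤ e^{-1}`, then `Nolin2008_lemma39_at ε` holds (decay in units of `n₀` is
decay in units of `L_ε(p) ≥ n₀`). [cite: Nolin2008, §7.4 Lemma 39, Remark 40 (arXiv: Lemma 37, Remark 38), proof] -/
theorem Nolin2008_lemma39_at_of_start' {ε : ℝ}
    (hstart : ∀ p : unitInterval, (p : ℝ) < 1 / 2 → 1 ≤ charLength ε p →
      ∃ n₀ : ℕ, 1 ≤ n₀ ∧ n₀ ≤ charLength ε p ∧
        324 * triLRCrossingProb p n₀ (3 * n₀) ≤ Real.exp (-1)) :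
    Nolin2008_lemma39_at ε := by
  intro k hk
  refine ⟨(k + 2) * Real.exp (1 / 4), by positivity, 1 / 4, by norm_num, ?_⟩
  intro p hp hL n
  obtain ⟨n₀, hn₀, hn₀L, hst⟩ := hstart p hp hL
  refine (triLRCrossingProb_decay_of_start p hn₀ hst hk n).trans ?_
  have hn₀pos : (0 : ℝ) < n₀ := by exact_mod_cast hn₀
  have hle : (n₀ : ℝ) ≤ charLength ε p := by exact_mod_cast hn₀L
  refine mul_le_mul_of_nonneg_left ?_ (by positivity)
  rw [Real.exp_le_exp, neg_le_neg_iff]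
  have e1 : 1 / 4 * (n : ℝ) / charLength ε p = (1 / 4 * n) * (1 / charLength ε p) := by ring
  have e2 : 1 / 4 * (n : ℝ) / n₀ = (1 / 4 * n) * (1 / n₀) := by ring
  rw [e1, e2]
  exact mul_le_mul_of_nonneg_left (one_div_le_one_div_of_le hn₀pos hle) (by positivity)

/-! ### The combinatorial dichotomy over the scales below `L` -/

/-- **Alternation is impossible.** Let `S` be any predicate on scales and `2 ≤ j_a`,
`2 j_a + 1 ≤ j_b`. If for every `j ∈ [j_a, j_b]` and every `j - 3 ≤ d ≤ j + 1` at least one of the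
scales `2j`, `3j + d + 1` satisfies `S`, then for some such `(j, d)` both do. (Otherwise exactly one
does; taking `m = 4j + 2`, which is `3j + d + 1` both for `(j, d = j + 1)` and for
`(j + 1, d = j - 2)` (`j ≥ 2`), shows `S(2j) ↔ S(2j + 2)` along `[j_a, j_b]`, while `(j_a, d = j_a + 1)` gives
`S(4 j_a + 2) ↔ ¬ S(2 j_a)` with `2 j_a + 1 ∈ [j_a, j_b]` — a contradiction.) [folklore] -/
theorem exists_pair_of_forall_or {S : ℕ → Prop} {ja jb : ℕ} (hja : 2 ≤ ja) (hab : 2 * ja + 1 ≤ jb)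
    (hF : ∀ j, ja ≤ j → j ≤ jb → ∀ d, j ≤ d + 3 → d ≤ j + 1 → S (2 * j) ∨ S (3 * j + d + 1)) :
    ∃ j d, ja ≤ j ∧ j ≤ jb ∧ j ≤ d + 3 ∧ d ≤ j + 1 ∧ S (2 * j) ∧ S (3 * j + d + 1) := by
  by_contra hG
  push Not at hG
  -- `S (4j+2) ↔ ¬ S (2j)` for `j ∈ [ja, jb]`
  have hup : ∀ j, ja ≤ j → j ≤ jb → (S (4 * j + 2) ↔ ¬ S (2 * j)) := by
    intro j h1 h2
    have e : 3 * j + (j + 1) + 1 = 4 * j + 2 := by ring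
    have hF' := hF j h1 h2 (j + 1) (by omega) le_rfl
    have hG' := hG j (j + 1) h1 h2 (by omega) le_rfl
    rw [e] at hF' hG'
    tauto
  -- `S (4j+2) ↔ ¬ S (2j+2)` for `j + 1 ∈ [ja, jb]`
  have hdown : ∀ j, ja ≤ j → j + 1 ≤ jb → (S (4 * j + 2) ↔ ¬ S (2 * (j + 1))) := by
    intro j h1 h2
    have e : 3 * (j + 1) + (j - 2) + 1 = 4 * j + 2 := by omega
    have hF' := hF (j + 1) (by omega) h2 (j - 2) (by omega) (by omega)
    have hG' := hG (j + 1) (j - 2) (by omega) h2 (by omega) (by omega)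
    rw [e] at hF' hG'
    tauto
  -- hence `S (2j)` is constant on `[ja, jb]`
  have hconst : ∀ n, ja + n ≤ jb → (S (2 * (ja + n)) ↔ S (2 * ja)) := by
    intro n
    induction n with
    | zero => intro _; simp
    | succ n ih =>
      intro hn
      have h1 := hup (ja + n) (by omega) (by omega)
      have h2 := hdown (ja + n) (by omega) (by omega)
      have h3 := ih (by omega)
      have e : ja + (n + 1) = ja + n + 1 := by ring
      rw [e]
      tauto
  have h1 := hconst (ja + 1) (by omega)
  have e : ja + (ja + 1) = 2 * ja + 1 := by ring
  rw [e] at h1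
  have h2 := hup ja le_rfl (by omega)
  have e2 : 2 * (2 * ja + 1) = 4 * ja + 2 := by ring
  rw [e2] at h1
  tauto

/-! ### The start of Lemma 39 from the two-scale RSW bounds -/

/-- **The start of Nolin's Lemma 39, unconditionally.** There is `ε₀ > 0` such that for every
`ε ≤ ε₀`, every `p < 1/2` and `L = L_ε(p) ≥ 1` there is a scale `1 ≤ n₀ ≤ L` with
`324 P_p(LR_𝕋(n₀, 3 n₀)) ≤ e^{-1}`. (Nolin 2008, proof of Lemma 39: "The RSW theory thus entails
that for all fixed `ε₁ > 0`, we can take `ε₀` sufficiently small to get automatically (and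
independently of `p`) that `P_p(𝒞_H([0, L] × [0, 2L])) ≤ ε₁`"; here obtained at a scale `n₀ ≤ L`
from the two-scale bounds of `TriRSWRounds.lean`: let `θ` be the tolerance of the high-probability
bound for `η = e^{-1}/324` and `φ = (θ/2)^466` the output of the product bound; for
`ε < φ`, at every `j ∈ [⌈(L-6)/12⌉, ⌊(L-2)/4⌋]` and `m ∈ [4j - 2, 4j + 2]` the scales `2j`, `m`
cannot both have `P_p(LR) ≥ θ` (the output crossing of `R(12j+6, 4j+2) ⊇`-wise dominates
`LR(R(L, L))`, of probability `≤ ε`), so by the combinatorial lemma some pair has both `< θ`, i.e. the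
closed sites cross both rhombi with probability `> 1 - θ`, and the high-probability bound for the
closed sites makes `P_p(LR_𝕋(4j+2, 12j+6)) ≤ η`; small `L` are handled by `p^{L+1} ≤ ε`.) [cite: Nolin2008, §7.4 (proof of Lemma 39; arXiv: Lemma 37), §3.1 Thm. "Russo–Seymour–Welsh" (arXiv: Thm. 2)] [cite: BollobasRiordan2006, Ch. 3 Lemma 4, Cor. 5] -/
theorem lemma39_start_holds :
    ∃ ε₀ : ℝ, 0 < ε₀ ∧ ∀ ε : ℝ, ε ≤ ε₀ → ∀ p : unitInterval, (p : ℝ) < 1 / 2 →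
      1 ≤ charLength ε p → ∃ n₀ : ℕ, 1 ≤ n₀ ∧ n₀ ≤ charLength ε p ∧
        324 * triLRCrossingProb p n₀ (3 * n₀) ≤ Real.exp (-1) := by
  set η : ℝ := Real.exp (-1) / 324 with hη
  have hη0 : 0 < η := by positivity
  obtain ⟨θ, hθ0, hθ1, hMS⟩ := TriHexagon.triLRCrossingProb_two_scale_flex_one hη0
  -- the product bound, with an opaque output constant `φ`
  obtain ⟨φ, hφ0, hMP⟩ : ∃ φ : ℝ, 0 < φ ∧ ∀ (q : unitInterval) (j d : ℕ), 6 ≤ j → j ≤ d + 3 →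
      d ≤ j + 1 → θ ≤ triLRCrossingProb q (2 * j) (2 * j) →
        θ ≤ triLRCrossingProb q (3 * j + d + 1) (3 * j + d + 1) →
          φ ≤ triLRCrossingProb q (12 * j + 6) (4 * j + 2) :=
    ⟨(θ / 2) ^ 466, by positivity, fun q j d hj hdj hd h1 h2 =>
      TriHexagon.triLRCrossingProb_two_scale_flex q hj hdj hd hθ0.le h1 h2⟩
  set ε₁ : ℝ := Real.exp (-1) / 1296 with hε₁
  have hε₁0 : 0 < ε₁ := by positivity
  set εB : ℝ := ε₁ ^ 100 with hεB
  have hεB0 : 0 < εB := by positivity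
  refine ⟨min (φ / 2) εB, lt_min (by positivity) hεB0, fun ε hε p hp hL => ?_⟩
  have hεφ : ε < φ := by linarith [min_le_left (φ / 2) εB]
  have hεB' : ε ≤ εB := hε.trans (min_le_right _ _)
  set L := charLength ε p with hLdef
  -- `P_p(LR(L, L)) ≤ ε`
  have hne : {n : ℕ | triLRCrossingProb (min p (σ p)) n n ≤ ε}.Nonempty := by
    by_contra h
    rw [Set.not_nonempty_iff_eq_empty] at h
    have : charLength ε p = 0 := by rw [charLength, h, Nat.sInf_empty]
    omega
  have hLL : triLRCrossingProb p L L ≤ ε := by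
    have hmin : min p (σ p) = p :=
      min_eq_left (Subtype.coe_le_coe.1 (by rw [unitInterval.coe_symm_eq]; linarith))
    have := triLRCrossingProb_charLength_le hne
    rwa [hmin] at this
  rcases lt_or_ge L 100 with hsmall | hlarge
  · -- small `L`: `p^{L+1} ≤ ε ≤ ε₁^100`, so `p ≤ ε₁` and `P_p(LR(1, 3)) ≤ 4p ≤ e^{-1}/324`
    refine ⟨1, le_rfl, hL, ?_⟩
    have hp0 : 0 ≤ (p : ℝ) := unitInterval.nonneg p
    have hp1 : (p : ℝ) ≤ 1 := unitInterval.le_one p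
    have hpow : (p : ℝ) ^ 100 ≤ ε₁ ^ 100 :=
      calc (p : ℝ) ^ 100 ≤ (p : ℝ) ^ (L + 1) := pow_le_pow_of_le_one hp0 hp1 (by omega)
        _ ≤ ε := (pow_succ_le_triLRCrossingProb p L L).trans hLL
        _ ≤ ε₁ ^ 100 := hεB'
    have hpε : (p : ℝ) ≤ ε₁ := (pow_le_pow_iff_left₀ hp0 hε₁0.le (by norm_num)).1 hpow
    have h13 := triLRCrossingProb_le_mul p 1 (3 * 1)
    push_cast at h13
    have h4 : triLRCrossingProb p 1 (3 * 1) ≤ 4 * ε₁ := by nlinarith [h13, hpε]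
    rw [hε₁] at h4
    linarith
  · -- large `L`: the dichotomy over `j ∈ [ja, jb]`
    set jb : ℕ := (L - 2) / 4 with hjb
    set ja : ℕ := (L + 5) / 12 with hja
    have hja6 : 6 ≤ ja := by omega
    have hab : 2 * ja + 1 ≤ jb := by omega
    have hjbL : 4 * jb + 2 ≤ L := by omega
    have hjaL : L ≤ 12 * ja + 6 := by omega
    -- the predicate "the scale is `θ`-strong for the closed sites"
    set S : ℕ → Prop := fun k => triLRCrossingProb p k k < θ with hS
    have hF : ∀ j, ja ≤ j → j ≤ jb → ∀ d, j ≤ d + 3 → d ≤ j + 1 → S (2 * j) ∨ S (3 * j + d + 1) := by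
      intro j h1 h2 d hd1 hd2
      by_contra hcon
      rw [not_or] at hcon
      simp only [hS, not_lt] at hcon
      have hMP' := hMP p j d (by omega) hd1 hd2 hcon.1 hcon.2
      have h3 : triLRCrossingProb p (12 * j + 6) (4 * j + 2) ≤ triLRCrossingProb p L L :=
        (triLRCrossingProb_anti_width p (by omega) _).trans (triLRCrossingProb_mono_height p L (by omega))
      linarith
    obtain ⟨j, d, hj1, hj2, hd1, hd2, hSj, hSm⟩ := exists_pair_of_forall_or (by omega) hab hF
    simp only [hS] at hSj hSm
    refine ⟨4 * j + 2, by omega, by omega, ?_⟩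
    have e3 : 3 * (4 * j + 2) = 12 * j + 6 := by ring
    rw [e3]
    -- the closed sites cross both rhombi with probability `≥ 1 - θ`
    have hq1 : 1 - θ ≤ triLRCrossingProb (σ p) (2 * j) (2 * j) := by
      have := triLRCrossingProb_add_eq_one p (2 * j) (2 * j); linarith
    have hq2 : 1 - θ ≤ triLRCrossingProb (σ p) (3 * j + d + 1) (3 * j + d + 1) := by
      have := triLRCrossingProb_add_eq_one p (3 * j + d + 1) (3 * j + d + 1); linarith
    have hlong := hMS (σ p) j d (by omega) hd1 hd2 hq1 hq2
    have hdual := triLRCrossingProb_add_eq_one p (4 * j + 2) (12 * j + 6)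
    have hlong' : 1 - Real.exp (-1) / 324 ≤ triLRCrossingProb (σ p) (12 * j + 6) (4 * j + 2) := by
      rw [hη] at hlong; exact hlong
    linarith

/-- **Nolin's Lemma 39 / Remark 40 at every small `ε`, unconditionally**: there is `ε₀ > 0` such
that `Nolin2008_lemma39_at ε` holds for every `ε ≤ ε₀`. (Previously: from `Nolin2008_RSW_one`,
`Nolin2008_lemma39_at_of_RSW_one`.) [cite: Nolin2008, §7.4 Lemma 39 and Remark 40 (arXiv 0711.4948: Lemma 37, Remark 38)] -/
theorem Nolin2008_lemma39_at_holds_small : ∃ ε₀ : ℝ, 0 < ε₀ ∧ ∀ ε : ℝ, ε ≤ ε₀ → Nolin2008_lemma39_at ε := by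
  obtain ⟨ε₀, hε₀, h⟩ := lemma39_start_holds
  exact ⟨ε₀, hε₀, fun ε hε => Nolin2008_lemma39_at_of_start' (h ε hε)⟩

/-- **`ν = 4/3` from two leaves.** The correlation-length exponent `triCorrLength_exponent`
(`ξ(p) = |p - 1/2|^{-4/3 + o(1)}`, Smirnov–Werner 2001, Thm. 1 (iii)–(iv)) follows from the four-arm
exponent `fourArm_exponent` and the near-critical pivotal count `Werner2009_lemma62` alone: the
Russo–Seymour–Welsh input of Nolin's Lemma 39 is now supplied by the two-scale bounds of
`TriRSWRounds.lean` (`Nolin2008_lemma39_at_holds_small`), Kesten's relation `Nolin2008_prop34` by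
`Nolin2008_prop34_of_expDecay`, and `ξ_rad ≍ L_ε` is unconditional
(`triCorrLength_exponent_of_lemma39_at'`). [cite: SmirnovWernerMRL2001, Thm. 1 (iii)–(iv) and the paragraph following it] [cite: Nolin2008, §7.3 Prop. 34, §7.4 Lemma 39 (arXiv: Prop. 32, Lemma 37)] [cite: BollobasRiordan2006, Ch. 3 Lemma 4, Cor. 5] -/
theorem triCorrLength_exponent_of_leaves₂ (h₄ : fourArm_exponent) (h62 : Werner2009_lemma62) :
    triCorrLength_exponent := by
  obtain ⟨ε₀, hε₀, h37⟩ := Nolin2008_lemma39_at_holds_small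
  exact triCorrLength_exponent_of_lemma39_at' h₄
    (Nolin2008_prop34_of_expDecay BollobasRiordan2006_tri_expDecay_holds h62)
    (lt_min hε₀ (by norm_num : (0 : ℝ) < 1 / 4))
    (lt_of_le_of_lt (min_le_right _ _) (by norm_num)) (h37 _ (min_le_left _ _))

end Literature.Probability.Percolation
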